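import Literature.Combinatorics.Optimization.SeparatingFunctionalPsdRank
import Literature.Combinatorics.Optimization.KnapsackPseudoDensity
import HarnessLib

/-!
# Lee–Raghavendra–Steurer 2015, Lemma 3.7 (the Fourier tail above a random `m`-subset), PROVED

LRS Lemma 3.7 (arXiv:1411.6317 p. 16–17; the second half of the proof of the degree-reduction
Theorem 3.5 = the named fact `LeeRaghavendraSteurer2015_thm35` of `SeparatingFunctionalPsdRank.lean`)
bounds `E_S E_x ‖B_{S,hi}(x)‖_F²` by Parseval and ONE combinatorial estimate: "Since `B` has degree at
most `ℓ`, we can upper bound the probability of the event `{|α ∩ S| > d/2}`,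
`P{|α ∩ S| > d/2} ≤ … ≤ ℓ^{d/2} m^{d/2} / (n−m)^{d/2}`" — for a fixed `α ⊆ [n]` with `|α| ≤ ℓ` and a
uniformly random `m`-subset `S ⊆ [n]`.  This file PROVES that estimate as a counting statement
(no probability spaces):

* `card_supersets_le` — `#{S : |S| = m, T ⊆ S} ≤ C(n − |T|, m − |T|)`;
* `card_filter_le_card_inter_le` — union bound over the `t`-subsets of `α`:
  `#{S : |S| = m, |α ∩ S| ≥ t} ≤ C(|α|, t) · C(n − t, m − t)`;
* `card_filter_le_card_inter_le_pow` — with `C(n,m)C(m,t) = C(n,t)C(n−t,m−t)`,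
  `C(a,t) ≤ a^t/t!`, `C(m,t) ≤ m^t/t!` and `C(n,t) ≥ (n+1−t)^t/t! ≥ (n−m)^t/t!`:
  `#{S : |S| = m, |α ∩ S| ≥ t} ≤ (|α| m/(n−m))^t · C(n,m)` for `t ≤ m < n`;
* `LeeRaghavendraSteurer2015_lemma37_count` — the printed form: for `|α| ≤ ℓ` and `m < n`,
  `#{S : |S| = m, |α ∩ S| > d/2} ≤ (ℓm/(n−m))^{d/2} · C(n,m)` (real exponent `d/2`; the event is
  `|α ∩ S| ≥ ⌊d/2⌋ + 1`, and `x^{⌊d/2⌋+1} ≤ x^{d/2}` for `x ≤ 1` while the bound is trivial for `x > 1`);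
* the Fourier part (p. 16–17): the high part `B_{S,hi} = Σ_{|α ∩ S| > d/2} B̂(α) χ_α` of a function on
  `{0,1}ⁿ` (`fourierHighPart`; the paper works on `{−1,1}ⁿ`, "a linear transformation on the domain"),
  Parseval `E_x B_{S,hi}(x)² = Σ_{|α∩S|>d/2} B̂(α)²` (`cubeExpect_fourierHighPart_sq`), and
  **Lemma 3.7** for scalar functions of degree `≤ ℓ`:
  `E_{S,x} B_{S,hi}(x)² ≤ (ℓm/(n−m))^{d/2} E_x B(x)²` (`LeeRaghavendraSteurer2015_lemma37`), plus the
  printed matrix-valued form with squared Frobenius norms, entrywise high parts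
  (`LeeRaghavendraSteurer2015_lemma37_matrix`).  With `E_{S,x}` = `subsetCubeExpect` of
  `SeparatingFunctionalPsdRank.lean`, this is one of the two lemmas of the printed proof of the
  degree-reduction Theorem 3.5 (`LeeRaghavendraSteurer2015_thm35`); the other (Lemma 3.6) needs the
  pseudo-density positivity on squares of functions of low degree in the variables `S`.

Source: J. R. Lee, P. Raghavendra, D. Steurer, STOC 2015 [LeeRaghavendraSteurer2015], held text
`paper:arxiv-1411.6317`, Lemma 3.7 and its proof (p. 16–17).  Theorems only.
-/

open Finset

namespace Literature.Combinatorics.Optimization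

/-- The `m`-subsets of `[n]` containing a fixed `T` inject (by `S ↦ S \ T`) into the
`(m − |T|)`-subsets of `[n] \ T`: there are at most `C(n − |T|, m − |T|)` of them.
[cite: LeeRaghavendraSteurer2015, Lemma 3.7 proof (p. 17: "we can upper bound the probability of the event")] -/
theorem card_supersets_le {n : ℕ} (m : ℕ) (T : Finset (Fin n)) :
    ((univ.powersetCard m).filter fun S : Finset (Fin n) => T ⊆ S).card ≤
      (n - T.card).choose (m - T.card) := by
  classical
  have hcard : ((univ \ T).powersetCard (m - T.card)).card = (n - T.card).choose (m - T.card) := by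
    rw [card_powersetCard, card_sdiff_of_subset (subset_univ T), card_univ, Fintype.card_fin]
  rw [← hcard]
  refine card_le_card_of_injOn (fun S => S \ T) (fun S hS => ?_) (fun S hS S' hS' h => ?_)
  · rw [mem_coe, mem_filter, mem_powersetCard] at hS
    rw [mem_coe, mem_powersetCard]
    exact ⟨sdiff_subset_sdiff (subset_univ _) le_rfl, by rw [card_sdiff_of_subset hS.2, hS.1.2]⟩
  · rw [mem_coe, mem_filter] at hS hS'
    have h' : S \ T = S' \ T := h
    rw [← sdiff_union_of_subset hS.2, ← sdiff_union_of_subset hS'.2, h']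

/-- **Union bound:** an `m`-subset meeting `α` in at least `t` points contains a `t`-subset of `α`,
so `#{S : |S| = m, |α ∩ S| ≥ t} ≤ C(|α|, t) · C(n − t, m − t)`.
[cite: LeeRaghavendraSteurer2015, Lemma 3.7 proof (p. 17)] -/
theorem card_filter_le_card_inter_le {n : ℕ} (m t : ℕ) (α : Finset (Fin n)) :
    ((univ.powersetCard m).filter fun S : Finset (Fin n) => t ≤ (α ∩ S).card).card ≤
      α.card.choose t * (n - t).choose (m - t) := by
  classical
  have hsub : ((univ.powersetCard m).filter fun S : Finset (Fin n) => t ≤ (α ∩ S).card) ⊆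
      (α.powersetCard t).biUnion fun T => (univ.powersetCard m).filter fun S => T ⊆ S := by
    intro S hS
    rw [mem_filter] at hS
    obtain ⟨T, hT, hTcard⟩ := exists_subset_card_eq hS.2
    rw [mem_biUnion]
    refine ⟨T, mem_powersetCard.2 ⟨hT.trans inter_subset_left, hTcard⟩, ?_⟩
    rw [mem_filter]
    exact ⟨hS.1, hT.trans inter_subset_right⟩
  refine (card_le_card hsub).trans ((card_biUnion_le).trans ?_)
  calc ∑ T ∈ α.powersetCard t, ((univ.powersetCard m).filter fun S : Finset (Fin n) => T ⊆ S).card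
      ≤ ∑ T ∈ α.powersetCard t, (n - t).choose (m - t) := by
        refine sum_le_sum fun T hT => ?_
        have hTc : T.card = t := (mem_powersetCard.1 hT).2
        have := card_supersets_le m T
        rwa [hTc] at this
    _ = α.card.choose t * (n - t).choose (m - t) := by
        rw [sum_const, card_powersetCard, smul_eq_mul]

/-- **The count as a power:** for `t ≤ m < n`,
`#{S : |S| = m, |α ∩ S| ≥ t} ≤ (|α|·m/(n−m))^t · C(n,m)` — from `C(n,m)C(m,t) = C(n,t)C(n−t,m−t)`,
`C(a,t) ≤ a^t/t!`, `C(m,t) ≤ m^t/t!`, `C(n,t) ≥ (n−m)^t/t!`.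
[cite: LeeRaghavendraSteurer2015, Lemma 3.7 proof (p. 17: "≤ ℓ^{d/2} m^{d/2}/(n−m)^{d/2}")] -/
theorem card_filter_le_card_inter_le_pow {n : ℕ} (m t : ℕ) (htm : t ≤ m) (hmn : m < n)
    (α : Finset (Fin n)) :
    (((univ.powersetCard m).filter fun S : Finset (Fin n) => t ≤ (α ∩ S).card).card : ℝ) ≤
      ((α.card : ℝ) * m / ((n : ℝ) - m)) ^ t * n.choose m := by
  set N := ((univ.powersetCard m).filter fun S : Finset (Fin n) => t ≤ (α ∩ S).card).card with hN
  set a := α.card with ha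
  have hmn' : m ≤ n := hmn.le
  have htn : t ≤ n := htm.trans hmn'
  -- the count times `C(n,t)` is at most `C(a,t) C(m,t) C(n,m)`
  have h1 : N * n.choose t ≤ a.choose t * m.choose t * n.choose m := by
    have hc := card_filter_le_card_inter_le m t α
    rw [← hN, ← ha] at hc
    have hmul : n.choose m * m.choose t = n.choose t * (n - t).choose (m - t) := Nat.choose_mul htm
    calc N * n.choose t ≤ a.choose t * (n - t).choose (m - t) * n.choose t :=
          Nat.mul_le_mul_right _ hc
      _ = a.choose t * (n.choose t * (n - t).choose (m - t)) := by ring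
      _ = a.choose t * (n.choose m * m.choose t) := by rw [hmul]
      _ = a.choose t * m.choose t * n.choose m := by ring
  -- real-number bounds on the binomials
  have hfact : (0 : ℝ) < (t.factorial : ℝ) := by exact_mod_cast Nat.factorial_pos t
  have hfact1 : (1 : ℝ) ≤ (t.factorial : ℝ) := by exact_mod_cast Nat.succ_le_of_lt (Nat.factorial_pos t)
  have hca : (a.choose t : ℝ) ≤ (a : ℝ) ^ t / t.factorial := Nat.choose_le_pow_div (α := ℝ) t a
  have hcm : (m.choose t : ℝ) ≤ (m : ℝ) ^ t / t.factorial := Nat.choose_le_pow_div (α := ℝ) t m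
  have hnm0 : (0 : ℝ) < (n : ℝ) - m := by
    have : (m : ℝ) < n := by exact_mod_cast hmn
    linarith
  have hcn : ((n : ℝ) - m) ^ t / t.factorial ≤ (n.choose t : ℝ) := by
    have h := Nat.pow_le_choose (α := ℝ) t n
    have h2 : ((n : ℝ) - m) ^ t ≤ ((n + 1 - t : ℕ) : ℝ) ^ t := by
      apply pow_le_pow_left₀ hnm0.le
      rw [Nat.cast_sub (by omega)]
      push_cast
      have : (t : ℝ) ≤ m := by exact_mod_cast htm
      linarith
    exact le_trans (div_le_div_of_nonneg_right h2 hfact.le) h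
  have hct0 : (0 : ℝ) < (n.choose t : ℝ) := by exact_mod_cast Nat.choose_pos htn
  have hCnm0 : (0 : ℝ) ≤ (n.choose m : ℝ) := Nat.cast_nonneg _
  have ha0 : (0 : ℝ) ≤ a := Nat.cast_nonneg _
  have hm0 : (0 : ℝ) ≤ m := Nat.cast_nonneg _
  -- assemble
  have h1R : (N : ℝ) * n.choose t ≤ (a.choose t : ℝ) * m.choose t * n.choose m := by
    exact_mod_cast h1
  have h2R : (N : ℝ) * n.choose t ≤ ((a : ℝ) ^ t / t.factorial) * ((m : ℝ) ^ t / t.factorial) * n.choose m :=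
    h1R.trans (mul_le_mul (mul_le_mul hca hcm (Nat.cast_nonneg _) (by positivity)) le_rfl hCnm0
      (by positivity))
  -- divide by `C(n,t) ≥ (n−m)^t/t!`
  have h3 : (N : ℝ) ≤ ((a : ℝ) ^ t / t.factorial) * ((m : ℝ) ^ t / t.factorial) * n.choose m /
      (((n : ℝ) - m) ^ t / t.factorial) := by
    rw [le_div_iff₀ (by positivity)]
    exact le_trans (mul_le_mul_of_nonneg_left hcn (Nat.cast_nonneg _)) h2R
  refine h3.trans ?_
  have hpos : (0 : ℝ) < ((n : ℝ) - m) ^ t := pow_pos hnm0 t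
  rw [div_pow, show ((a : ℝ) ^ t / t.factorial) * ((m : ℝ) ^ t / t.factorial) * n.choose m /
      (((n : ℝ) - m) ^ t / t.factorial) =
      ((a : ℝ) * m) ^ t / ((n : ℝ) - m) ^ t * n.choose m * (1 / t.factorial) by
    rw [mul_pow]; field_simp]
  calc ((a : ℝ) * m) ^ t / ((n : ℝ) - m) ^ t * n.choose m * (1 / t.factorial)
      ≤ ((a : ℝ) * m) ^ t / ((n : ℝ) - m) ^ t * n.choose m * 1 := by
        apply mul_le_mul_of_nonneg_left _ (by positivity)
        rw [div_le_one hfact]; exact hfact1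
    _ = ((a : ℝ) * m) ^ t / ((n : ℝ) - m) ^ t * n.choose m := mul_one _

/-- **Lee–Raghavendra–Steurer 2015, the counting bound of Lemma 3.7 (PROVED).**  For `α ⊆ [n]` with
`|α| ≤ ℓ` and `m < n`, the number of `m`-subsets `S ⊆ [n]` with `|α ∩ S| > d/2` is at most
`(ℓm/(n−m))^{d/2} · C(n,m)`, i.e. "`P{|α ∩ S| > d/2} ≤ ℓ^{d/2} m^{d/2}/(n−m)^{d/2}`" for a uniformly
random `m`-subset `S`. [cite: LeeRaghavendraSteurer2015, Lemma 3.7 proof (p. 17)] -/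
theorem LeeRaghavendraSteurer2015_lemma37_count {n : ℕ} (m d ℓ : ℕ) (hmn : m < n)
    (α : Finset (Fin n)) (hα : α.card ≤ ℓ) :
    (((univ.powersetCard m).filter fun S : Finset (Fin n) => d / 2 < (α ∩ S).card).card : ℝ) ≤
      (((ℓ : ℝ) * m) / ((n : ℝ) - m)) ^ ((d : ℝ) / 2) * n.choose m := by
  classical
  set t := d / 2 + 1 with ht
  have hset : ((univ.powersetCard m).filter fun S : Finset (Fin n) => d / 2 < (α ∩ S).card) =
      ((univ.powersetCard m).filter fun S : Finset (Fin n) => t ≤ (α ∩ S).card) := by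
    rfl
  rw [hset]
  have hnm0 : (0 : ℝ) < (n : ℝ) - m := by
    have : (m : ℝ) < n := by exact_mod_cast hmn
    linarith
  set x : ℝ := ((ℓ : ℝ) * m) / ((n : ℝ) - m) with hx
  have hx0 : 0 ≤ x := by positivity
  have hCnm0 : (0 : ℝ) ≤ (n.choose m : ℝ) := Nat.cast_nonneg _
  by_cases htm : t ≤ m
  · -- the power bound with exponent `t = ⌊d/2⌋ + 1`
    have h1 := card_filter_le_card_inter_le_pow m t htm hmn α
    have h2 : ((α.card : ℝ) * m / ((n : ℝ) - m)) ^ t ≤ x ^ t := by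
      apply pow_le_pow_left₀ (by positivity)
      rw [hx]
      apply div_le_div_of_nonneg_right _ hnm0.le
      exact mul_le_mul_of_nonneg_right (by exact_mod_cast hα) (Nat.cast_nonneg _)
    have h3 : (((univ.powersetCard m).filter fun S : Finset (Fin n) => t ≤ (α ∩ S).card).card : ℝ)
        ≤ x ^ t * n.choose m := h1.trans (mul_le_mul_of_nonneg_right h2 hCnm0)
    by_cases hx1 : x ≤ 1
    · -- `x^t ≤ x^{d/2}` since `t ≥ d/2`
      refine h3.trans (mul_le_mul_of_nonneg_right ?_ hCnm0)
      rw [← Real.rpow_natCast]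
      apply Real.rpow_le_rpow_of_exponent_ge' hx0 hx1 (by positivity)
      rw [ht]; push_cast
      have : ((d / 2 : ℕ) : ℝ) ≥ (d : ℝ) / 2 - 1 := by
        have h := Nat.div_add_mod d 2
        have h' : ((2 * (d / 2) + d % 2 : ℕ) : ℝ) = d := by exact_mod_cast h
        push_cast at h'
        have hmod : ((d % 2 : ℕ) : ℝ) ≤ 1 := by exact_mod_cast Nat.lt_succ_iff.mp (Nat.mod_lt d two_pos)
        linarith
      linarith
    · -- `x > 1`: the bound exceeds the number of all `m`-subsets
      push Not at hx1
      have hall : (((univ.powersetCard m).filter fun S : Finset (Fin n) => t ≤ (α ∩ S).card).card : ℝ)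
          ≤ n.choose m := by
        have := card_filter_le (univ.powersetCard m) (fun S : Finset (Fin n) => t ≤ (α ∩ S).card)
        rw [card_powersetCard, card_univ, Fintype.card_fin] at this
        exact_mod_cast this
      refine hall.trans ?_
      have : (1 : ℝ) ≤ x ^ ((d : ℝ) / 2) := Real.one_le_rpow hx1.le (by positivity)
      nlinarith
  · -- `t > m`: no `m`-subset meets `α` in `t` points
    push Not at htm
    have hempty : ((univ.powersetCard m).filter fun S : Finset (Fin n) => t ≤ (α ∩ S).card) = ∅ := by
      rw [filter_eq_empty_iff]
      intro S hS hle
      have hS' := (mem_powersetCard.1 hS).2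
      have : (α ∩ S).card ≤ S.card := card_le_card inter_subset_right
      omega
    rw [hempty, card_empty, Nat.cast_zero]
    positivity


/-! ### The Fourier tail above `S` and Lemma 3.7 -/

section Fourier

open Literature.Probability.RandomGraphs.LowDegree (walsh)
open Literature.Computability.Complexity.LowDegree (cubeFourierCoeff sum_cubeFourierCoeff_mul_walsh)

variable {n : ℕ}

/-- The **high part above `S`** of `g : {0,1}ⁿ → ℝ` at level `d`:
`g_{S,hi} = Σ_{α : |α ∩ S| > d/2} ĝ(α) χ_α` (`g = g_{S,low} + g_{S,hi}`, `g_{S,low}` = the part of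
degree `≤ d/2` in the variables `S`). [cite: LeeRaghavendraSteurer2015, Thm 3.5 proof (p. 16: "B_{S,low} = Σ_{|α∩S| ≤ d/2} B̂_α χ_α") and Lemma 3.7 proof (p. 17)] -/
noncomputable def fourierHighPart (S : Finset (Fin n)) (d : ℕ) (g : (Fin n → Bool) → ℝ) :
    (Fin n → Bool) → ℝ :=
  fun x => ∑ α ∈ univ.filter (fun α : Finset (Fin n) => d / 2 < (α ∩ S).card),
    cubeFourierCoeff g α * walsh α x

/-- **Parseval for the high part:** `E_x g_{S,hi}(x)² = Σ_{|α ∩ S| > d/2} ĝ(α)²`.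
[cite: LeeRaghavendraSteurer2015, Lemma 3.7 proof (p. 17: "E_x ‖B_{S,hi}(x)‖_F² = Σ_{|α∩S|>d/2} ‖B̂(α)‖_F²")] -/
theorem cubeExpect_fourierHighPart_sq (S : Finset (Fin n)) (d : ℕ) (g : (Fin n → Bool) → ℝ) :
    cubeExpect (fun x => fourierHighPart S d g x ^ 2) =
      ∑ α ∈ univ.filter (fun α : Finset (Fin n) => d / 2 < (α ∩ S).card), cubeFourierCoeff g α ^ 2 := by
  classical
  have hco : ∀ T, cubeFourierCoeff (fourierHighPart S d g) T =
      if T ∈ univ.filter (fun α : Finset (Fin n) => d / 2 < (α ∩ S).card) then cubeFourierCoeff g T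
      else 0 := fun T => cubeFourierCoeff_sum_walsh _ _ T
  have hsq : (fun x => fourierHighPart S d g x ^ 2) =
      fun x => fourierHighPart S d g x * fourierHighPart S d g x := by
    funext x; ring
  rw [hsq, cubeExpect_mul_eq_sum_cubeFourierCoeff]
  simp_rw [hco]
  have hite : ∀ T : Finset (Fin n),
      ((if T ∈ univ.filter (fun α : Finset (Fin n) => d / 2 < (α ∩ S).card) then cubeFourierCoeff g T
        else 0) *
        (if T ∈ univ.filter (fun α : Finset (Fin n) => d / 2 < (α ∩ S).card) then cubeFourierCoeff g T
        else 0)) =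
      if T ∈ univ.filter (fun α : Finset (Fin n) => d / 2 < (α ∩ S).card) then cubeFourierCoeff g T ^ 2
      else 0 := by
    intro T; split_ifs <;> ring
  simp_rw [hite]
  rw [← Finset.sum_filter, Finset.filter_mem_eq_inter, Finset.univ_inter]

/-- **Parseval:** `E_x g(x)² = Σ_α ĝ(α)²`. [cite: LeeRaghavendraSteurer2015, Lemma 3.7 proof (p. 17: "Σ_α ‖B̂_α‖_F² = E_x ‖B(x)‖_F²")] -/
theorem cubeExpect_sq_eq_sum_cubeFourierCoeff_sq (g : (Fin n → Bool) → ℝ) :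
    cubeExpect (fun x => g x ^ 2) = ∑ α : Finset (Fin n), cubeFourierCoeff g α ^ 2 := by
  have hsq : (fun x => g x ^ 2) = fun x => g x * g x := by funext x; ring
  rw [hsq, cubeExpect_mul_eq_sum_cubeFourierCoeff]
  exact sum_congr rfl fun α _ => by ring

/-- `E_{S,x}` of a finite sum of functions. [cite: LeeRaghavendraSteurer2015, §3.1 (p. 14: E_{S,x})] -/
theorem subsetCubeExpect_finset_sum {m : ℕ} {ι : Type*} (s : Finset ι)
    (F : ι → {S : Finset (Fin n) // S.card = m} → (Fin n → Bool) → ℝ) :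
    subsetCubeExpect n m (fun S x => ∑ i ∈ s, F i S x) = ∑ i ∈ s, subsetCubeExpect n m (F i) := by
  unfold subsetCubeExpect
  rw [← Finset.sum_div]
  congr 1
  calc ∑ S, ∑ x, ∑ i ∈ s, F i S x = ∑ S, ∑ i ∈ s, ∑ x, F i S x := by
        refine sum_congr rfl fun S _ => ?_
        rw [Finset.sum_comm]
    _ = ∑ i ∈ s, ∑ S, ∑ x, F i S x := by rw [Finset.sum_comm]

/-- **Lee–Raghavendra–Steurer 2015, Lemma 3.7 (scalar form, PROVED).**  For `g : {0,1}ⁿ → ℝ` of degree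
`≤ ℓ` and `m < n`: `E_{S,x} g_{S,hi}(x)² ≤ (ℓm/(n−m))^{d/2} · E_x g(x)²`, the expectation over `S`
being uniform over `m`-subsets of `[n]` — by Parseval and the counting bound
`LeeRaghavendraSteurer2015_lemma37_count` applied to each `α` with `ĝ(α) ≠ 0` (so `|α| ≤ ℓ`).
[cite: LeeRaghavendraSteurer2015, Lemma 3.7 (p. 16–17)] -/
theorem LeeRaghavendraSteurer2015_lemma37 {m d ℓ : ℕ} (hmn : m < n) (g : (Fin n → Bool) → ℝ)
    (hg : HasDegreeLE ℓ g) :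
    subsetCubeExpect n m (fun S x => fourierHighPart S.1 d g x ^ 2) ≤
      (((ℓ : ℝ) * m) / ((n : ℝ) - m)) ^ ((d : ℝ) / 2) * cubeExpect (fun x => g x ^ 2) := by
  classical
  set K : ℝ := (((ℓ : ℝ) * m) / ((n : ℝ) - m)) ^ ((d : ℝ) / 2) with hK
  have hK0 : 0 ≤ K := by
    have hnm0 : (0 : ℝ) < (n : ℝ) - m := by
      have : (m : ℝ) < n := by exact_mod_cast hmn
      linarith
    rw [hK]; positivity
  have hCpos : (0 : ℝ) < (n.choose m : ℝ) := by exact_mod_cast Nat.choose_pos hmn.le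
  have hcard : (Fintype.card {S : Finset (Fin n) // S.card = m} : ℝ) = n.choose m := by
    rw [Fintype.card_finset_len, Fintype.card_fin]
  -- rewrite `E_{S,x}` as `(Σ_S E_x ⋯)/C(n,m)` and use Parseval for each `S`
  have hE : subsetCubeExpect n m (fun S x => fourierHighPart S.1 d g x ^ 2) =
      (∑ S : {S : Finset (Fin n) // S.card = m},
        ∑ α ∈ univ.filter (fun α : Finset (Fin n) => d / 2 < (α ∩ S.1).card), cubeFourierCoeff g α ^ 2) /
        n.choose m := by
    unfold subsetCubeExpect
    rw [hcard]
    have : ∀ S : {S : Finset (Fin n) // S.card = m},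
        ∑ x, fourierHighPart S.1 d g x ^ 2 =
          2 ^ n * ∑ α ∈ univ.filter (fun α : Finset (Fin n) => d / 2 < (α ∩ S.1).card),
            cubeFourierCoeff g α ^ 2 := by
      intro S
      have h := cubeExpect_fourierHighPart_sq S.1 d g
      unfold cubeExpect at h
      rw [div_eq_iff (by positivity)] at h
      rw [h]; ring
    simp_rw [this]
    rw [← Finset.mul_sum]
    field_simp
  rw [hE, div_le_iff₀ hCpos]
  -- exchange the sums: `Σ_S Σ_{α : |α∩S|>d/2} ĝ(α)² = Σ_α ĝ(α)² · #{S : |α∩S| > d/2}`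
  have hswap : (∑ S : {S : Finset (Fin n) // S.card = m},
        ∑ α ∈ univ.filter (fun α : Finset (Fin n) => d / 2 < (α ∩ S.1).card), cubeFourierCoeff g α ^ 2) =
      ∑ α : Finset (Fin n), cubeFourierCoeff g α ^ 2 *
        ((univ.filter fun S : {S : Finset (Fin n) // S.card = m} => d / 2 < (α ∩ S.1).card).card : ℝ) := by
    have h1 : ∀ S : {S : Finset (Fin n) // S.card = m},
        ∑ α ∈ univ.filter (fun α : Finset (Fin n) => d / 2 < (α ∩ S.1).card), cubeFourierCoeff g α ^ 2 =
          ∑ α : Finset (Fin n), if d / 2 < (α ∩ S.1).card then cubeFourierCoeff g α ^ 2 else 0 := by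
      intro S; rw [Finset.sum_filter]
    simp_rw [h1]
    rw [Finset.sum_comm]
    refine sum_congr rfl fun α _ => ?_
    rw [← Finset.sum_filter, Finset.sum_const, nsmul_eq_mul, mul_comm]
  rw [hswap]
  -- the count of `m`-subsets over the subtype equals the count over `powersetCard m univ`
  have hcount : ∀ α : Finset (Fin n),
      ((univ.filter fun S : {S : Finset (Fin n) // S.card = m} => d / 2 < (α ∩ S.1).card).card : ℝ) =
        ((univ.powersetCard m).filter fun S : Finset (Fin n) => d / 2 < (α ∩ S).card).card := by
    intro α
    norm_cast
    refine Finset.card_bij (fun S _ => S.1) (fun S hS => ?_) (fun S _ S' _ h => Subtype.ext h)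
      (fun S hS => ?_)
    · rw [mem_filter] at hS ⊢
      exact ⟨mem_powersetCard.2 ⟨subset_univ _, S.2⟩, hS.2⟩
    · rw [mem_filter, mem_powersetCard] at hS
      exact ⟨⟨S, hS.1.2⟩, by rw [mem_filter]; exact ⟨mem_univ _, hS.2⟩, rfl⟩
  -- bound each term
  have hterm : ∀ α : Finset (Fin n), cubeFourierCoeff g α ^ 2 *
      ((univ.filter fun S : {S : Finset (Fin n) // S.card = m} => d / 2 < (α ∩ S.1).card).card : ℝ) ≤
        cubeFourierCoeff g α ^ 2 * (K * n.choose m) := by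
    intro α
    by_cases hα : α.card ≤ ℓ
    · rw [hcount]
      exact mul_le_mul_of_nonneg_left (LeeRaghavendraSteurer2015_lemma37_count m d ℓ hmn α hα)
        (sq_nonneg _)
    · push Not at hα
      rw [hg.cubeFourierCoeff_eq_zero hα]
      simp
  calc ∑ α : Finset (Fin n), cubeFourierCoeff g α ^ 2 *
        ((univ.filter fun S : {S : Finset (Fin n) // S.card = m} => d / 2 < (α ∩ S.1).card).card : ℝ)
      ≤ ∑ α : Finset (Fin n), cubeFourierCoeff g α ^ 2 * (K * n.choose m) := sum_le_sum fun α _ => hterm α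
    _ = K * cubeExpect (fun x => g x ^ 2) * n.choose m := by
        rw [← Finset.sum_mul, cubeExpect_sq_eq_sum_cubeFourierCoeff_sq]; ring

/-- **Lee–Raghavendra–Steurer 2015, Lemma 3.7 (matrix-valued form, PROVED).**  For
`B : {0,1}ⁿ → ℝ^{p×q}` with every entry of degree `≤ ℓ` and `m < n`, with the entrywise high parts
`(B_{S,hi})_{ij} = (B_{ij})_{S,hi}` and the squared Frobenius norm `‖X‖_F² = Σ_{ij} X_{ij}²`:
`E_{S,x} ‖B_{S,hi}(x)‖_F² ≤ ℓ^{d/2} m^{d/2}/(n−m)^{d/2} · E_x ‖B(x)‖_F²`.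
[cite: LeeRaghavendraSteurer2015, Lemma 3.7 (p. 16–17)] -/
theorem LeeRaghavendraSteurer2015_lemma37_matrix {m d ℓ p q : ℕ} (hmn : m < n)
    (B : (Fin n → Bool) → Matrix (Fin p) (Fin q) ℝ) (hB : ∀ i j, HasDegreeLE ℓ fun x => B x i j) :
    subsetCubeExpect n m (fun S x => frobSq (Matrix.of fun i j => fourierHighPart S.1 d (fun y => B y i j) x)) ≤
      (((ℓ : ℝ) * m) / ((n : ℝ) - m)) ^ ((d : ℝ) / 2) * cubeExpect (fun x => frobSq (B x)) := by
  set K : ℝ := (((ℓ : ℝ) * m) / ((n : ℝ) - m)) ^ ((d : ℝ) / 2) with hK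
  -- both sides are sums over the entries `(i, j)`
  have hL : subsetCubeExpect n m
      (fun S x => frobSq (Matrix.of fun i j => fourierHighPart S.1 d (fun y => B y i j) x)) =
      ∑ i : Fin p, ∑ j : Fin q,
        subsetCubeExpect n m (fun S x => fourierHighPart S.1 d (fun y => B y i j) x ^ 2) := by
    simp only [frobSq, Matrix.of_apply]
    rw [subsetCubeExpect_finset_sum univ
      (fun i S x => ∑ j : Fin q, fourierHighPart S.1 d (fun y => B y i j) x ^ 2)]
    refine sum_congr rfl fun i _ => ?_
    exact subsetCubeExpect_finset_sum univ
      (fun j S x => fourierHighPart S.1 d (fun y => B y i j) x ^ 2)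
  have hR : cubeExpect (fun x => frobSq (B x)) =
      ∑ i : Fin p, ∑ j : Fin q, cubeExpect (fun x => B x i j ^ 2) := by
    simp only [frobSq]
    rw [cubeExpect_finset_sum univ (fun i x => ∑ j : Fin q, B x i j ^ 2)]
    refine sum_congr rfl fun i _ => ?_
    exact cubeExpect_finset_sum univ (fun j x => B x i j ^ 2)
  rw [hL, hR, Finset.mul_sum]
  refine sum_le_sum fun i _ => ?_
  rw [Finset.mul_sum]
  exact sum_le_sum fun j _ => LeeRaghavendraSteurer2015_lemma37 hmn (fun y => B y i j) (hB i j)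

end Fourier

end Literature.Combinatorics.Optimization
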